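import Summits.CriticalPhenomena.PercolationContinuityZ3.Theorems.PercNearOneGluingNoHeavyQuantThreePortBoxKit
import HarnessLib

/-!
# The three-port residual kit, VI: the DT chain with V-floors (box certificates for a hair REGION)

builds on p205010 (kernel theorem, internal audit signed; external expert review pending)

Support file (`--supports stmt-CriticalPhenomena-4575`), seat `prim-quant-p1` (gen 5); memo `run/shared/lean/prim/quant/P1-SURPLUS.md` §16.
No definitions, no named facts, no sorries; standard axioms.  Pure real algebra.

`ThreePort.dtBoxV_b_false` / `dtBoxV_c_false`: the DT chain of `…QuantThreePortBoxDT` (Gladkov Lemma 1.2, weak row, with the caps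
`Ubc ≤ κ_a U0`, `Uac ≤ κ_b U0`, `Uab ≤ κ_c U0`, `κ_v = Tv/Vv`) with the three lower bounds `Va, Vb, Vc ≤ V_v` taken as HYPOTHESES instead of
the box-corner values.  On the region `{V_a ≥ v₀}` (no hair outweighs the union of the other two by more than `−v₀`) the tiles feed
`Va := max(corner, v₀)`, which keeps `κ_a` bounded next to the dominance boundary `V_a = 0` where the corner bound degenerates; this is what
lets the tiling of `…QuantThreePortVTiles*` cover ALL hair sizes.  Same chain, same numeric side condition (with `Va, Vb, Vc` symbols).
[cite: Gladkov2024, Lemma 1.2 (2)]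
-/

noncomputable section

namespace Summit.CriticalPhenomena.PercolationContinuityZ3.Theorems

namespace ThreePort

/-! ### The DT chain on a box with V-floors -/

/-- **DT box certificate with V-floors, apex `b`.**  As `dtBox_b_false`, but the lower bounds `Va, Vb, Vc` of the three exchange
coefficients `V_v` are PARAMETERS with hypotheses `hV_a, hV_b, hV_c` (the caller supplies the corner bound `V_ge_box` or a region
hypothesis such as `V_a ≥ 1/40`); the numeric condition `hnum` is that of `dtBox_b_false` with `Va, Vb, Vc` in place of the corner values.
[this work] -/
theorem dtBoxV_b_false (α β γ U0 Uab Uac Ubc U3 la ha lb hb lc hc C3hi C3lo Va Vb Vc : ℝ)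
    (a1 : la ≤ α) (a2 : α ≤ ha) (b1 : lb ≤ β) (b2 : β ≤ hb) (c1 : lc ≤ γ) (c2 : γ ≤ hc)
    (hV_a : Va ≤ β + γ - β * γ - α) (hV_b : Vb ≤ α + γ - α * γ - β) (hV_c : Vc ≤ α + β - α * β - γ)
    (h0 : 0 ≤ U0) (hab : 0 ≤ Uab) (hac : 0 ≤ Uac) (hbc : 0 ≤ Ubc) (_h3 : 0 ≤ U3)
    (hsum : Uab + Uac + Ubc + U3 + U0 = 1)
    (ga : U0 * ((1 - α) * β * γ - α * (1 - β) * (1 - γ)) + Ubc * (β + γ - β * γ - α) < 0)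
    (gb : U0 * ((1 - β) * α * γ - β * (1 - α) * (1 - γ)) + Uac * (α + γ - α * γ - β) < 0)
    (gc : U0 * ((1 - γ) * α * β - γ * (1 - α) * (1 - β)) + Uab * (α + β - α * β - γ) < 0)
    (rB1 : U0 ^ 2 ≤ (Ubc + U0) * (Uab + (Uac + U0) ^ 2))
    (hSig : 2 < (α + β + γ) + (α + β - 2 * α * β) * Uab + (α + γ - 2 * α * γ) * Uac + (β + γ - 2 * β * γ) * Ubc +
      ((1 - α) * (β + γ - β * γ) + (1 - β) * (α + γ - α * γ) + (1 - γ) * (α + β - α * β)) * U3)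
    (hnum : 0 ≤ la ∧ 0 ≤ lb ∧ 0 ≤ lc ∧ ha ≤ 1 / 2 ∧ hb ≤ 1 / 2 ∧ hc ≤ 1 / 2 ∧
      0 < (ha * (1 - lb) * (1 - lc) - (1 - ha) * lb * lc) ∧ 0 ≤ (hb * (1 - la) * (1 - lc) - (1 - hb) * la * lc) ∧
      0 < (hc * (1 - la) * (1 - lb) - (1 - hc) * la * lb) ∧
      0 < Va ∧ 0 < Vb ∧ 0 < Vc ∧
      (1 - la) * (lb + lc - lb * lc) + (1 - lb) * (la + lc - la * lc) + (1 - lc) * (la + lb - la * lb) ≤ C3hi ∧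
      (1 - la) * (lb + hc - lb * hc) + (1 - lb) * (la + hc - la * hc) + (1 - hc) * (la + lb - la * lb) ≤ C3hi ∧
      (1 - la) * (hb + lc - hb * lc) + (1 - hb) * (la + lc - la * lc) + (1 - lc) * (la + hb - la * hb) ≤ C3hi ∧
      (1 - la) * (hb + hc - hb * hc) + (1 - hb) * (la + hc - la * hc) + (1 - hc) * (la + hb - la * hb) ≤ C3hi ∧
      (1 - ha) * (lb + lc - lb * lc) + (1 - lb) * (ha + lc - ha * lc) + (1 - lc) * (ha + lb - ha * lb) ≤ C3hi ∧
      (1 - ha) * (lb + hc - lb * hc) + (1 - lb) * (ha + hc - ha * hc) + (1 - hc) * (ha + lb - ha * lb) ≤ C3hi ∧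
      (1 - ha) * (hb + lc - hb * lc) + (1 - hb) * (ha + lc - ha * lc) + (1 - lc) * (ha + hb - ha * hb) ≤ C3hi ∧
      (1 - ha) * (hb + hc - hb * hc) + (1 - hb) * (ha + hc - ha * hc) + (1 - hc) * (ha + hb - ha * hb) ≤ C3hi ∧
      C3lo ≤ (1 - la) * (lb + lc - lb * lc) + (1 - lb) * (la + lc - la * lc) + (1 - lc) * (la + lb - la * lb) ∧
      C3lo ≤ (1 - la) * (lb + hc - lb * hc) + (1 - lb) * (la + hc - la * hc) + (1 - hc) * (la + lb - la * lb) ∧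
      C3lo ≤ (1 - la) * (hb + lc - hb * lc) + (1 - hb) * (la + lc - la * lc) + (1 - lc) * (la + hb - la * hb) ∧
      C3lo ≤ (1 - la) * (hb + hc - hb * hc) + (1 - hb) * (la + hc - la * hc) + (1 - hc) * (la + hb - la * hb) ∧
      C3lo ≤ (1 - ha) * (lb + lc - lb * lc) + (1 - lb) * (ha + lc - ha * lc) + (1 - lc) * (ha + lb - ha * lb) ∧
      C3lo ≤ (1 - ha) * (lb + hc - lb * hc) + (1 - lb) * (ha + hc - ha * hc) + (1 - hc) * (ha + lb - ha * lb) ∧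
      C3lo ≤ (1 - ha) * (hb + lc - hb * lc) + (1 - hb) * (ha + lc - ha * lc) + (1 - lc) * (ha + hb - ha * hb) ∧
      C3lo ≤ (1 - ha) * (hb + hc - hb * hc) + (1 - hb) * (ha + hc - ha * hc) + (1 - hc) * (ha + hb - ha * hb) ∧
      1 / 2 < C3lo ∧
      (hc * (1 - la) * (1 - lb) - (1 - hc) * la * lb) / Vc * (1 + (ha * (1 - lb) * (1 - lc) - (1 - ha) * lb * lc) / Va) < 1 ∧
      ha + hb + hc + C3hi - (1 / (1 + (ha * (1 - lb) * (1 - lc) - (1 - ha) * lb * lc) / Va) - (hc * (1 - la) * (1 - lb) - (1 - hc) * la * lb) / Vc) /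
          (1 + (hb * (1 - la) * (1 - lc) - (1 - hb) * la * lc) / Vb) ^ 2 * (C3lo + (C3lo - (hb + hc - 2 * hb * hc)) * ((ha * (1 - lb) * (1 - lc) - (1 - ha) * lb * lc) / Va)) ≤ 2) : False := by
  obtain ⟨hla, hlb, hlc, hha, hhb, hhc, hTa0, hTb0, hTc0, hVa0, hVb0, hVc0, v1, v2, v3, v4, v5, v6, v7, v8,
    w1, w2, w3, w4, w5, w6, w7, w8, hC3lo, hpos, hfin⟩ := hnum
  set Ta : ℝ := ha * (1 - lb) * (1 - lc) - (1 - ha) * lb * lc with hTa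
  set Tb : ℝ := hb * (1 - la) * (1 - lc) - (1 - hb) * la * lc with hTb
  set Tc : ℝ := hc * (1 - la) * (1 - lb) - (1 - hc) * la * lb with hTc
  set CPa : ℝ := hb + hc - 2 * hb * hc with hCPa
  set c3 : ℝ := (1 - α) * (β + γ - β * γ) + (1 - β) * (α + γ - α * γ) + (1 - γ) * (α + β - α * β) with hc3
  -- hairs in [0, 1/2]
  have hα1 : α ≤ 1 / 2 := a2.trans hha
  have hβ1 : β ≤ 1 / 2 := b2.trans hhb
  have hγ1 : γ ≤ 1 / 2 := c2.trans hhc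
  -- corner bounds
  have hT_a : α * (1 - β) * (1 - γ) - (1 - α) * β * γ ≤ Ta :=
    Tm_le_box α β γ la ha lb hb lc hc a1 a2 b1 b2 c1 c2 hla hlb hlc (by linarith only [hha]) (by linarith only [hhb])
      (by linarith only [hhc])
  have hT_b : β * (1 - α) * (1 - γ) - (1 - β) * α * γ ≤ Tb :=
    Tm_le_box β α γ lb hb la ha lc hc b1 b2 a1 a2 c1 c2 hlb hla hlc (by linarith only [hhb]) (by linarith only [hha])
      (by linarith only [hhc])
  have hT_c : γ * (1 - α) * (1 - β) - (1 - γ) * α * β ≤ Tc :=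
    Tm_le_box γ α β lc hc la ha lb hb c1 c2 a1 a2 b1 b2 hlc hla hlb (by linarith only [hhc]) (by linarith only [hha])
      (by linarith only [hhb])
  have hc3hi : c3 ≤ C3hi := c3_le_of_vertices α β γ la ha lb hb lc hc C3hi a1 a2 b1 b2 c1 c2 v1 v2 v3 v4 v5 v6 v7 v8
  have hc3lo : C3lo ≤ c3 := c3_ge_of_vertices α β γ la ha lb hb lc hc C3lo a1 a2 b1 b2 c1 c2 w1 w2 w3 w4 w5 w6 w7 w8
  have hca : β + γ - 2 * β * γ ≤ CPa := cpair_le_box β γ hb hc b2 c2 hhb hγ1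
  have hcb1 : α + γ - 2 * α * γ ≤ 1 / 2 := by
    have : 0 ≤ (1 - 2 * α) * (1 - 2 * γ) := mul_nonneg (by linarith only [hα1]) (by linarith only [hγ1])
    linarith only [this]
  have hcc1 : α + β - 2 * α * β ≤ 1 / 2 := by
    have : 0 ≤ (1 - 2 * α) * (1 - 2 * β) := mul_nonneg (by linarith only [hα1]) (by linarith only [hβ1])
    linarith only [this]
  have hCPa1 : CPa ≤ 1 / 2 := by
    have : 0 ≤ (1 - 2 * hb) * (1 - 2 * hc) := mul_nonneg (by linarith only [hhb]) (by linarith only [hhc])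
    rw [hCPa]; linarith only [this]
  have hCPa0 : 0 ≤ CPa := by
    have h1 : 0 ≤ hb := hlb.trans (b1.trans b2)
    have h2 : 0 ≤ hc := hlc.trans (c1.trans c2)
    have : 0 ≤ hb * (1 - 2 * hc) := mul_nonneg h1 (by linarith only [hhc])
    rw [hCPa]; linarith only [this, h2]
  -- the failed exchanges as caps
  have ga' : Ubc * (β + γ - β * γ - α) < U0 * (α * (1 - β) * (1 - γ) - (1 - α) * β * γ) := by linarith only [ga]
  have gb' : Uac * (α + γ - α * γ - β) < U0 * (β * (1 - α) * (1 - γ) - (1 - β) * α * γ) := by linarith only [gb]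
  have gc' : Uab * (α + β - α * β - γ) < U0 * (γ * (1 - α) * (1 - β) - (1 - γ) * α * β) := by linarith only [gc]
  have hU0 : 0 < U0 := by
    by_contra h
    have hz : U0 = 0 := le_antisymm (not_lt.1 h) h0
    have h1 : 0 ≤ Uab * (α + β - α * β - γ) := mul_nonneg hab (by linarith only [hV_c, hVc0])
    rw [hz, zero_mul] at gc'
    exact absurd gc' (not_lt.2 h1)
  -- caps with constants
  set κa : ℝ := Ta / Va with hκa
  set κb : ℝ := Tb / Vb with hκb
  set κc : ℝ := Tc / Vc with hκc
  have hκa0 : 0 ≤ κa := div_nonneg hTa0.le hVa0.le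
  have hκb0 : 0 ≤ κb := div_nonneg hTb0 hVb0.le
  have hκc0 : 0 < κc := div_pos hTc0 hVc0
  have hUbc : Ubc ≤ κa * U0 := by
    have h1 : Va * Ubc ≤ Ubc * (β + γ - β * γ - α) := by rw [mul_comm]; exact mul_le_mul_of_nonneg_left hV_a hbc
    have h2 : U0 * (α * (1 - β) * (1 - γ) - (1 - α) * β * γ) ≤ U0 * Ta := mul_le_mul_of_nonneg_left hT_a h0
    have h3' : Ubc * Va ≤ Ta * U0 := by linarith only [h1, h2, ga']
    rw [hκa, div_mul_eq_mul_div, le_div_iff₀ hVa0]; exact h3'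
  have hUac : Uac ≤ κb * U0 := by
    have h1 : Vb * Uac ≤ Uac * (α + γ - α * γ - β) := by rw [mul_comm]; exact mul_le_mul_of_nonneg_left hV_b hac
    have h2 : U0 * (β * (1 - α) * (1 - γ) - (1 - β) * α * γ) ≤ U0 * Tb := mul_le_mul_of_nonneg_left hT_b h0
    have h3' : Uac * Vb ≤ Tb * U0 := by linarith only [h1, h2, gb']
    rw [hκb, div_mul_eq_mul_div, le_div_iff₀ hVb0]; exact h3'
  have hUab : Uab ≤ κc * U0 := by
    have h1 : Vc * Uab ≤ Uab * (α + β - α * β - γ) := by rw [mul_comm]; exact mul_le_mul_of_nonneg_left hV_c hab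
    have h2 : U0 * (γ * (1 - α) * (1 - β) - (1 - γ) * α * β) ≤ U0 * Tc := mul_le_mul_of_nonneg_left hT_c h0
    have h3' : Uab * Vc ≤ Tc * U0 := by linarith only [h1, h2, gc']
    rw [hκc, div_mul_eq_mul_div, le_div_iff₀ hVc0]; exact h3'
  -- the DT row with the caps: `U0 ≤ (Ubc + U0)·Y`, `Y = κc + (1+κb)² U0`
  set Y : ℝ := κc + (1 + κb) ^ 2 * U0 with hY
  have hY0 : 0 < Y := by rw [hY]; nlinarith only [hκc0, hU0, sq_nonneg (1 + κb)]
  have hq1 : Uab + (Uac + U0) ^ 2 ≤ κc * U0 + (1 + κb) ^ 2 * U0 ^ 2 := by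
    have h1 : Uac + U0 ≤ (1 + κb) * U0 := by linarith only [hUac]
    have h2 : 0 ≤ Uac + U0 := by linarith only [hac, h0]
    have h3' : (Uac + U0) * (Uac + U0) ≤ ((1 + κb) * U0) * ((1 + κb) * U0) := mul_le_mul h1 h1 h2 (h2.trans h1)
    nlinarith only [h3', hUab]
  have hmain : U0 ≤ (Ubc + U0) * Y := by
    have h1 : U0 ^ 2 ≤ (Ubc + U0) * (κc * U0 + (1 + κb) ^ 2 * U0 ^ 2) :=
      rB1.trans (mul_le_mul_of_nonneg_left hq1 (by linarith only [hbc, h0]))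
    have e : (Ubc + U0) * (κc * U0 + (1 + κb) ^ 2 * U0 ^ 2) = ((Ubc + U0) * Y) * U0 := by rw [hY]; ring
    rw [e, pow_two] at h1
    exact le_of_mul_le_mul_right h1 hU0
  -- the range `U0 ≥ U0min`
  have hrange : 1 ≤ (1 + κa) * Y := by
    have h1 : (Ubc + U0) * Y ≤ (κa * U0 + U0) * Y := mul_le_mul_of_nonneg_right (by linarith only [hUbc]) hY0.le
    have h2 : U0 * 1 ≤ U0 * ((1 + κa) * Y) := by linarith only [hmain, h1]
    exact le_of_mul_le_mul_left h2 hU0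
  have hA1 : 0 < 1 + κa := by linarith only [hκa0]
  have hq0 : 0 < (1 + κb) ^ 2 := by positivity
  have hU0min : (1 / (1 + κa) - κc) / (1 + κb) ^ 2 ≤ U0 := by
    rw [div_le_iff₀ hq0, sub_le_iff_le_add, div_le_iff₀ hA1]
    have e : (1 + κa) * Y = (U0 * (1 + κb) ^ 2 + κc) * (1 + κa) := by rw [hY]; ring
    linarith only [hrange, e]
  -- lower bound for `G = C3lo·U0 + (C3lo − CPa)·Ubc`
  have hL : U0 / Y - U0 ≤ Ubc := by
    rw [sub_le_iff_le_add, div_le_iff₀ hY0]; linarith only [hmain]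
  have hmono : (1 / (1 + κa) - κc) / (1 + κb) ^ 2 * (1 + κa) ≤ U0 / Y := by
    rw [le_div_iff₀ hY0]
    set m : ℝ := (1 / (1 + κa) - κc) / (1 + κb) ^ 2 with hm
    have e1 : m * (1 + κb) ^ 2 = 1 / (1 + κa) - κc := by rw [hm]; field_simp
    have e2 : m * (1 + κa) * Y = m * (1 + κa) * κc + (1 - (1 + κa) * κc) * U0 := by
      have : m * (1 + κa) * ((1 + κb) ^ 2 * U0) = (m * (1 + κb) ^ 2) * (1 + κa) * U0 := by ring
      rw [hY, mul_add, this, e1]; field_simp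
    rw [e2]
    have h1 : 0 ≤ (1 + κa) * κc * (U0 - m) := mul_nonneg (mul_nonneg hA1.le hκc0.le) (by linarith only [hU0min])
    nlinarith only [h1]
  have hG : (1 / (1 + κa) - κc) / (1 + κb) ^ 2 * (C3lo + (C3lo - CPa) * κa) ≤ C3lo * U0 + (C3lo - CPa) * Ubc := by
    have hD : 0 ≤ C3lo - CPa := by linarith only [hC3lo, hCPa1]
    have h1 : (C3lo - CPa) * (U0 / Y - U0) ≤ (C3lo - CPa) * Ubc := mul_le_mul_of_nonneg_left hL hD
    have h2 : (C3lo - CPa) * ((1 / (1 + κa) - κc) / (1 + κb) ^ 2 * (1 + κa)) ≤ (C3lo - CPa) * (U0 / Y) :=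
      mul_le_mul_of_nonneg_left hmono hD
    have h3' : CPa * ((1 / (1 + κa) - κc) / (1 + κb) ^ 2) ≤ CPa * U0 := mul_le_mul_of_nonneg_left hU0min hCPa0
    have e : (1 / (1 + κa) - κc) / (1 + κb) ^ 2 * (C3lo + (C3lo - CPa) * κa) =
        CPa * ((1 / (1 + κa) - κc) / (1 + κb) ^ 2) + (C3lo - CPa) * ((1 / (1 + κa) - κc) / (1 + κb) ^ 2 * (1 + κa)) := by
      ring
    rw [e]
    have e2 : C3lo * U0 + (C3lo - CPa) * (U0 / Y - U0) = CPa * U0 + (C3lo - CPa) * (U0 / Y) := by ring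
    linarith only [h1, h2, h3', e2]
  -- `Σ > 2` gives `2 < S + C3hi − G`
  have hS : 2 < ha + hb + hc + C3hi - (C3lo * U0 + (C3lo - CPa) * Ubc) := by
    have hU3 : U3 = 1 - U0 - Uab - Uac - Ubc := by linarith only [hsum]
    have e1 : c3 * U3 = c3 - c3 * U0 - c3 * Uab - c3 * Uac - c3 * Ubc := by rw [hU3]; ring
    have t1 : C3lo * U0 ≤ c3 * U0 := mul_le_mul_of_nonneg_right hc3lo h0
    have t2 : (C3lo - CPa) * Ubc ≤ (c3 - (β + γ - 2 * β * γ)) * Ubc :=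
      mul_le_mul_of_nonneg_right (by linarith only [hc3lo, hca]) hbc
    have t3 : 0 ≤ (c3 - (α + γ - 2 * α * γ)) * Uac := mul_nonneg (by linarith only [hc3lo, hC3lo, hcb1]) hac
    have t4 : 0 ≤ (c3 - (α + β - 2 * α * β)) * Uab := mul_nonneg (by linarith only [hc3lo, hC3lo, hcc1]) hab
    linarith only [hSig, e1, t1, t2, t3, t4, a2, b2, c2, hc3hi]
  linarith only [hS, hG, hfin]

/-- **DT box certificate with V-floors, apex `c`** (`dtBoxV_b_false` with the roles of `b` and `c` exchanged): uses the weak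
Lemma-1.2 row `U0² ≤ (Ubc+U0)(Uac+(Uab+U0)²)`. [this work] -/
theorem dtBoxV_c_false (α β γ U0 Uab Uac Ubc U3 la ha lb hb lc hc C3hi C3lo Va Vb Vc : ℝ)
    (a1 : la ≤ α) (a2 : α ≤ ha) (b1 : lb ≤ β) (b2 : β ≤ hb) (c1 : lc ≤ γ) (c2 : γ ≤ hc)
    (hV_a : Va ≤ β + γ - β * γ - α) (hV_b : Vb ≤ α + γ - α * γ - β) (hV_c : Vc ≤ α + β - α * β - γ)
    (h0 : 0 ≤ U0) (hab : 0 ≤ Uab) (hac : 0 ≤ Uac) (hbc : 0 ≤ Ubc) (h3 : 0 ≤ U3)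
    (hsum : Uab + Uac + Ubc + U3 + U0 = 1)
    (ga : U0 * ((1 - α) * β * γ - α * (1 - β) * (1 - γ)) + Ubc * (β + γ - β * γ - α) < 0)
    (gb : U0 * ((1 - β) * α * γ - β * (1 - α) * (1 - γ)) + Uac * (α + γ - α * γ - β) < 0)
    (gc : U0 * ((1 - γ) * α * β - γ * (1 - α) * (1 - β)) + Uab * (α + β - α * β - γ) < 0)
    (rC1 : U0 ^ 2 ≤ (Ubc + U0) * (Uac + (Uab + U0) ^ 2))
    (hSig : 2 < (α + β + γ) + (α + β - 2 * α * β) * Uab + (α + γ - 2 * α * γ) * Uac + (β + γ - 2 * β * γ) * Ubc +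
      ((1 - α) * (β + γ - β * γ) + (1 - β) * (α + γ - α * γ) + (1 - γ) * (α + β - α * β)) * U3)
    (hnum : 0 ≤ la ∧ 0 ≤ lc ∧ 0 ≤ lb ∧ ha ≤ 1 / 2 ∧ hc ≤ 1 / 2 ∧ hb ≤ 1 / 2 ∧
      0 < (ha * (1 - lc) * (1 - lb) - (1 - ha) * lc * lb) ∧ 0 ≤ (hc * (1 - la) * (1 - lb) - (1 - hc) * la * lb) ∧
      0 < (hb * (1 - la) * (1 - lc) - (1 - hb) * la * lc) ∧
      0 < Va ∧ 0 < Vc ∧ 0 < Vb ∧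
      (1 - la) * (lc + lb - lc * lb) + (1 - lc) * (la + lb - la * lb) + (1 - lb) * (la + lc - la * lc) ≤ C3hi ∧
      (1 - la) * (lc + hb - lc * hb) + (1 - lc) * (la + hb - la * hb) + (1 - hb) * (la + lc - la * lc) ≤ C3hi ∧
      (1 - la) * (hc + lb - hc * lb) + (1 - hc) * (la + lb - la * lb) + (1 - lb) * (la + hc - la * hc) ≤ C3hi ∧
      (1 - la) * (hc + hb - hc * hb) + (1 - hc) * (la + hb - la * hb) + (1 - hb) * (la + hc - la * hc) ≤ C3hi ∧
      (1 - ha) * (lc + lb - lc * lb) + (1 - lc) * (ha + lb - ha * lb) + (1 - lb) * (ha + lc - ha * lc) ≤ C3hi ∧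
      (1 - ha) * (lc + hb - lc * hb) + (1 - lc) * (ha + hb - ha * hb) + (1 - hb) * (ha + lc - ha * lc) ≤ C3hi ∧
      (1 - ha) * (hc + lb - hc * lb) + (1 - hc) * (ha + lb - ha * lb) + (1 - lb) * (ha + hc - ha * hc) ≤ C3hi ∧
      (1 - ha) * (hc + hb - hc * hb) + (1 - hc) * (ha + hb - ha * hb) + (1 - hb) * (ha + hc - ha * hc) ≤ C3hi ∧
      C3lo ≤ (1 - la) * (lc + lb - lc * lb) + (1 - lc) * (la + lb - la * lb) + (1 - lb) * (la + lc - la * lc) ∧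
      C3lo ≤ (1 - la) * (lc + hb - lc * hb) + (1 - lc) * (la + hb - la * hb) + (1 - hb) * (la + lc - la * lc) ∧
      C3lo ≤ (1 - la) * (hc + lb - hc * lb) + (1 - hc) * (la + lb - la * lb) + (1 - lb) * (la + hc - la * hc) ∧
      C3lo ≤ (1 - la) * (hc + hb - hc * hb) + (1 - hc) * (la + hb - la * hb) + (1 - hb) * (la + hc - la * hc) ∧
      C3lo ≤ (1 - ha) * (lc + lb - lc * lb) + (1 - lc) * (ha + lb - ha * lb) + (1 - lb) * (ha + lc - ha * lc) ∧
      C3lo ≤ (1 - ha) * (lc + hb - lc * hb) + (1 - lc) * (ha + hb - ha * hb) + (1 - hb) * (ha + lc - ha * lc) ∧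
      C3lo ≤ (1 - ha) * (hc + lb - hc * lb) + (1 - hc) * (ha + lb - ha * lb) + (1 - lb) * (ha + hc - ha * hc) ∧
      C3lo ≤ (1 - ha) * (hc + hb - hc * hb) + (1 - hc) * (ha + hb - ha * hb) + (1 - hb) * (ha + hc - ha * hc) ∧
      1 / 2 < C3lo ∧
      (hb * (1 - la) * (1 - lc) - (1 - hb) * la * lc) / Vb * (1 + (ha * (1 - lc) * (1 - lb) - (1 - ha) * lc * lb) / Va) < 1 ∧
      ha + hc + hb + C3hi - (1 / (1 + (ha * (1 - lc) * (1 - lb) - (1 - ha) * lc * lb) / Va) - (hb * (1 - la) * (1 - lc) - (1 - hb) * la * lc) / Vb) /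
          (1 + (hc * (1 - la) * (1 - lb) - (1 - hc) * la * lb) / Vc) ^ 2 * (C3lo + (C3lo - (hc + hb - 2 * hc * hb)) * ((ha * (1 - lc) * (1 - lb) - (1 - ha) * lc * lb) / Va)) ≤ 2) : False :=
  dtBoxV_b_false α γ β U0 Uac Uab Ubc U3 la ha lc hc lb hb C3hi C3lo Va Vc Vb a1 a2 c1 c2 b1 b2 (by linarith only [hV_a]) hV_c hV_b
    h0 hac hab hbc h3 (by linarith only [hsum]) (by linarith only [ga]) gc gb rC1 (by linarith only [hSig]) hnum

end ThreePort

end Summit.CriticalPhenomena.PercolationContinuityZ3.Theorems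

end
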